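import Summits.ABC.ABC.Theorems.IneffectiveSubspaceUniformSadicTowerFourNormalForm
import Summits.ABC.ABC.Theorems.IneffectiveSubspaceUniformSadicTowerFourFlatSteepSplit
import Summits.ABC.ABC.Theorems.IneffectiveSubspaceUniformSadicTowerFourHeavyPlacesReductions

/-!
# `UniformSadicTowerFour` (stmt-ABC-14937) = abc with the θ-ADAPTIVE radical (line `flat-steep-split`, normal form)

The crux ("Ridout at level four") quantifies over a budget `K` and a set `S` of at most `K` primes.  This file
removes BOTH: the crux is equivalent (`uniformSadicTowerFour_iff_adaptive`) to the single-dial statement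

  `∀ θ > 0, ∀ ε > 0, ∃ C, ∀ abc triples:  c < C · R_θ(a, b, c)^(1+ε)`,

where the θ-ADAPTIVE RADICAL `R_θ` charges a prime `p ∣ abc` whose block is DOMINANT (`p^{v_p(abc)} ≥ c^θ`)
the single factor `p`, and every other prime the 4-rounded charge `p^⌈v_p(abc)/4⌉` — in Lean, `R_θ` is the
mixed radical `M_H` at THE set `H` of θ-dominant primes (characterised by `p ∈ H ↔ p ∣ abc ∧ c^θ ≤ p^{v_p}`,
so no decidability or choice of `S` is involved).  Reading: `θ ↦ R_θ` interpolates between the `K = 0` face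
(`θ > 1`: nothing is dominant, `R_θ = rad₄`) and `ABC` itself (`θ → 0`: everything dominant, `R = rad`); the
crux is exactly the conjunction over all `θ > 0`, i.e. abc in which only the (fewer than `3/θ`) dominant
prime powers are charged as in `rad`, and the deep NON-dominant primes (`v_p ≥ 5`, `p < c^{θ/5}`) are
over-charged by `p^{⌈v_p/4⌉ − 1}`.  Equivalently it suffices to have it for `θ ∈ (0, 1/4]`
(`uniformSadicTowerFour_of_adaptive`); at a fixed `θ` the adaptive statement is the conjunction of the two
registered stubs of the line at that `θ` (flat face: `H = ∅`; heavy places: `S ⊆ H`, `mixed_anti`).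

Proof: `⟹` is the landed normal form (`MixedRadical.stub_normalForm`) at `S = H`, `K = ⌈3/θ⌉₊`
(`HeavyPlaces.card_le_ceil`); `⟸` goes through the landed glue `uniformSadicTowerFour_of_flat_of_heavy`.
-/

-- `Summit.<Summit>.<Problem>` is the mandated summit-side namespace (CONVENTIONS §2); for the
-- single-conjunct summit `ABC` the two coincide, so the duplicate `ABC.ABC` is deliberate.
set_option linter.dupNamespace false

namespace Summit.ABC.ABC.Theorems.UniformSadicTowerFour.AdaptiveRadical

open Literature.NumberTheory.DiophantineGeometry (IsABCTriple)
open Summit.ABC.ABC.Theses.IneffectiveSubspace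
open Summit.ABC.ABC.Theorems.UniformSadicTowerFour.MixedRadical (stub_normalForm)
open Summit.ABC.ABC.Theorems.UniformSadicTowerFour.FlatSteepSplit
  (uniformSadicTowerFour_of_flat_of_heavy)
open Summit.ABC.ABC.Theorems.UniformSadicTowerFour.HeavyPlaces (card_le_ceil)
open scoped BigOperators

/-- **Enlarging the discounted set lowers the mixed radical**: for `S ⊆ H ⊆ supp N`,
`M_H(N) ≤ M_S(N)` (a prime moved into the discounted set is charged `p ≤ p^⌈v_p/4⌉`). [folklore] -/
theorem mixed_anti (N : ℕ) {S H : Finset ℕ} (hSH : S ⊆ H) (hH : H ⊆ N.primeFactors) :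
    (∏ p ∈ H, p) * ∏ p ∈ N.primeFactors \ H, p ^ ((N.factorization p + 3) / 4) ≤
      (∏ p ∈ S, p) * ∏ p ∈ N.primeFactors \ S, p ^ ((N.factorization p + 3) / 4) := by
  classical
  have hsub : N.primeFactors \ H ⊆ N.primeFactors \ S :=
    Finset.sdiff_subset_sdiff (le_refl _) hSH
  have hsd : (N.primeFactors \ S) \ (N.primeFactors \ H) = H \ S := by
    ext q
    simp only [Finset.mem_sdiff]
    constructor
    · rintro ⟨⟨hq, hqS⟩, h2⟩
      exact ⟨Classical.by_contradiction fun hqH => h2 ⟨hq, hqH⟩, hqS⟩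
    · rintro ⟨hqH, hqS⟩
      exact ⟨⟨hH hqH, hqS⟩, fun h => h.2 hqH⟩
  rw [← Finset.prod_sdiff hsub, hsd, ← Finset.prod_sdiff hSH]
  have hle : ∏ p ∈ H \ S, p ≤ ∏ p ∈ H \ S, p ^ ((N.factorization p + 3) / 4) := by
    refine Finset.prod_le_prod' fun p hp => ?_
    have hpN := Nat.mem_primeFactors.mp (hH (Finset.mem_sdiff.mp hp).1)
    have hv : 0 < N.factorization p := hpN.1.factorization_pos_of_dvd hpN.2.2 hpN.2.1
    calc p = p ^ 1 := (pow_one p).symm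
      _ ≤ p ^ ((N.factorization p + 3) / 4) := Nat.pow_le_pow_right hpN.1.pos (by omega)
  calc (∏ p ∈ H \ S, p) * (∏ p ∈ S, p) *
        ∏ p ∈ N.primeFactors \ H, p ^ ((N.factorization p + 3) / 4)
      = (∏ p ∈ S, p) * ((∏ p ∈ H \ S, p) *
          ∏ p ∈ N.primeFactors \ H, p ^ ((N.factorization p + 3) / 4)) := by ring
    _ ≤ (∏ p ∈ S, p) * ((∏ p ∈ H \ S, p ^ ((N.factorization p + 3) / 4)) *
          ∏ p ∈ N.primeFactors \ H, p ^ ((N.factorization p + 3) / 4)) :=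
        Nat.mul_le_mul_left _ (Nat.mul_le_mul_right _ hle)

/-- **Crux ⟹ adaptive abc at every `θ > 0`** (registered stub `adaptive_of_uniformSadicTowerFour`):
the normal form at the set `H` of θ-dominant primes, which has `|H| ≤ ⌈3/θ⌉₊`. [folklore] -/
theorem adaptive_of_uniformSadicTowerFour (hU : UniformSadicTowerFour) :
    ∀ θ : ℝ, 0 < θ → ∀ ε : ℝ, 0 < ε → ∃ C : ℝ, 0 < C ∧ ∀ a b c : ℕ, IsABCTriple a b c →
      ∀ H : Finset ℕ, (∀ p, p ∈ H ↔ p ∈ (a * b * c).primeFactors ∧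
        (c : ℝ) ^ θ ≤ ((p ^ (a * b * c).factorization p : ℕ) : ℝ)) →
      (c : ℝ) < C * ((((∏ p ∈ H, p) *
        ∏ p ∈ (a * b * c).primeFactors \ H, p ^ (((a * b * c).factorization p + 3) / 4) : ℕ) : ℝ)) ^
          (1 + ε) := by
  intro θ hθ ε hε
  obtain ⟨C, hC, hK⟩ := (stub_normalForm.mp hU) ⌈3 / θ⌉₊ ε hε
  refine ⟨C, hC, fun a b c habc H hH => ?_⟩
  have hprime : ∀ p ∈ H, p.Prime := fun p hp => Nat.prime_of_mem_primeFactors ((hH p).mp hp).1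
  exact hK H (card_le_ceil habc hθ hprime fun p hp => ((hH p).mp hp).2) hprime a b c habc

/-- **Adaptive abc for `θ ∈ (0, 1/4]` ⟹ crux**, through the landed glue of the line: the flat face is the
case `H = ∅`, the heavy places at `S` follow from the case `S ⊆ H` by `mixed_anti`. [folklore] -/
theorem uniformSadicTowerFour_of_adaptive
    (h : ∀ θ : ℝ, 0 < θ → θ ≤ 1 / 4 → ∀ ε : ℝ, 0 < ε → ∃ C : ℝ, 0 < C ∧ ∀ a b c : ℕ,
      IsABCTriple a b c →
      ∀ H : Finset ℕ, (∀ p, p ∈ H ↔ p ∈ (a * b * c).primeFactors ∧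
        (c : ℝ) ^ θ ≤ ((p ^ (a * b * c).factorization p : ℕ) : ℝ)) →
      (c : ℝ) < C * ((((∏ p ∈ H, p) *
        ∏ p ∈ (a * b * c).primeFactors \ H, p ^ (((a * b * c).factorization p + 3) / 4) : ℕ) : ℝ)) ^
          (1 + ε)) :
    UniformSadicTowerFour := by
  classical
  refine uniformSadicTowerFour_of_flat_of_heavy ?_ ?_
  · -- the flat face at `θ ≤ 1/4`: `H = ∅`
    intro θ hθ hθ4 ε hε
    obtain ⟨C, hC, hA⟩ := h θ hθ hθ4 ε hε
    refine ⟨C, hC, fun a b c habc hflat => ?_⟩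
    have key := hA a b c habc ∅ fun p =>
      ⟨fun hp => absurd hp (Finset.notMem_empty p),
        fun hp => absurd hp.2 (not_le.mpr (hflat p hp.1))⟩
    simpa [Finset.sdiff_empty] using key
  · -- the heavy places (budget form): `H` = the primes dominant at `θ' = min θ (1/4)`, `S ⊆ H`
    intro K θ hθ ε hε
    set θ' := min θ (1 / 4) with hθ'
    have hθ'0 : 0 < θ' := lt_min hθ (by norm_num)
    have hθ'4 : θ' ≤ 1 / 4 := min_le_right _ _
    have hθ'θ : θ' ≤ θ := min_le_left _ _
    obtain ⟨C, hC, hA⟩ := h θ' hθ'0 hθ'4 ε hε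
    refine ⟨C, hC, fun S _ _ hS a b c habc hheavy => ?_⟩
    set N := a * b * c with hN
    set H := N.primeFactors.filter
      (fun p => (c : ℝ) ^ θ' ≤ ((p ^ N.factorization p : ℕ) : ℝ)) with hHdef
    have hHiff : ∀ p, p ∈ H ↔ p ∈ N.primeFactors ∧
        (c : ℝ) ^ θ' ≤ ((p ^ N.factorization p : ℕ) : ℝ) := fun p => Finset.mem_filter
    have key := hA a b c habc H hHiff
    have hc : 0 < c := by obtain ⟨ha, hb, hsum, _⟩ := habc; omega
    have hc2 : (1 : ℝ) < c := by
      obtain ⟨ha, hb, hsum, _⟩ := habc; exact_mod_cast (show 1 < c by omega)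
    have hN0 : N ≠ 0 := Nat.mul_ne_zero (Nat.mul_ne_zero habc.1.ne' habc.2.1.ne') hc.ne'
    -- `S ⊆ H ⊆ supp N`
    have hSH : S ⊆ H := by
      intro p hp
      have hpθ' : (c : ℝ) ^ θ' ≤ ((p ^ N.factorization p : ℕ) : ℝ) :=
        (Real.rpow_le_rpow_of_exponent_le hc2.le hθ'θ).trans (hheavy p hp)
      refine (hHiff p).mpr ⟨?_, hpθ'⟩
      by_contra hpN
      have hv : N.factorization p = 0 := Nat.factorization_eq_zero_of_not_dvd fun hdvd =>
        hpN (Nat.mem_primeFactors.mpr ⟨hS p hp, hdvd, hN0⟩)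
      rw [hv, pow_zero, Nat.cast_one] at hpθ'
      have : (1 : ℝ) < (c : ℝ) ^ θ' := Real.one_lt_rpow hc2 hθ'0
      linarith
    have hHsub : H ⊆ N.primeFactors := Finset.filter_subset _ _
    have hmono : ((((∏ p ∈ H, p) *
        ∏ p ∈ N.primeFactors \ H, p ^ ((N.factorization p + 3) / 4) : ℕ) : ℝ)) ≤
        (((∏ p ∈ S, p) * ∏ p ∈ N.primeFactors \ S, p ^ ((N.factorization p + 3) / 4) : ℕ) : ℝ) := by
      exact_mod_cast mixed_anti N hSH hHsub
    refine key.trans_le (mul_le_mul_of_nonneg_left ?_ hC.le)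
    exact Real.rpow_le_rpow (by positivity) hmono (by linarith)

/-- **`UniformSadicTowerFour` ⟺ abc with the θ-adaptive radical for every `θ > 0`.** [folklore] -/
theorem uniformSadicTowerFour_iff_adaptive :
    UniformSadicTowerFour ↔
      ∀ θ : ℝ, 0 < θ → ∀ ε : ℝ, 0 < ε → ∃ C : ℝ, 0 < C ∧ ∀ a b c : ℕ, IsABCTriple a b c →
        ∀ H : Finset ℕ, (∀ p, p ∈ H ↔ p ∈ (a * b * c).primeFactors ∧
          (c : ℝ) ^ θ ≤ ((p ^ (a * b * c).factorization p : ℕ) : ℝ)) →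
        (c : ℝ) < C * ((((∏ p ∈ H, p) *
          ∏ p ∈ (a * b * c).primeFactors \ H, p ^ (((a * b * c).factorization p + 3) / 4) : ℕ) : ℝ)) ^
            (1 + ε) :=
  ⟨adaptive_of_uniformSadicTowerFour,
    fun h => uniformSadicTowerFour_of_adaptive fun θ hθ _ => h θ hθ⟩

/-- … and it suffices to have the adaptive statement for `θ ∈ (0, 1/4]` (the dial only matters as
`θ → 0⁺`). [folklore] -/
theorem uniformSadicTowerFour_iff_adaptive_quarter :
    UniformSadicTowerFour ↔
      ∀ θ : ℝ, 0 < θ → θ ≤ 1 / 4 → ∀ ε : ℝ, 0 < ε → ∃ C : ℝ, 0 < C ∧ ∀ a b c : ℕ,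
        IsABCTriple a b c →
        ∀ H : Finset ℕ, (∀ p, p ∈ H ↔ p ∈ (a * b * c).primeFactors ∧
          (c : ℝ) ^ θ ≤ ((p ^ (a * b * c).factorization p : ℕ) : ℝ)) →
        (c : ℝ) < C * ((((∏ p ∈ H, p) *
          ∏ p ∈ (a * b * c).primeFactors \ H, p ^ (((a * b * c).factorization p + 3) / 4) : ℕ) : ℝ)) ^
            (1 + ε) :=
  ⟨fun hU θ hθ _ => adaptive_of_uniformSadicTowerFour hU θ hθ, uniformSadicTowerFour_of_adaptive⟩

end Summit.ABC.ABC.Theorems.UniformSadicTowerFour.AdaptiveRadical
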